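import Summits.BirchSwinnertonDyer.BirchSwinnertonDyer.Theorems.AdditiveKolyvaginRoadLevelDefs
import HarnessLib

/-!
# Route `AdditiveKolyvaginRoad`, crux `KolyvaginPrimitiveAdditive` (item stmt-BirchSwinnertonDyer-20132):
# MEMBERSHIP DICTIONARIES for the p-generic canonical spaces `levelSelmerSubgroupP` ∕ `SelQP` ∕ `SelRelQP`
# (cell `pub/bsd-wall`, lead prover `bsd-wall-akr-p1` g3; `--supports stmt-BirchSwinnertonDyer-20132`, helper;
# p-generic port of zhang3-p1's `Theorems/KolyvaginRoadThreeMethod2Membership.lean`, `3 ↦ p`, ordinary ↦ TORIC)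

WHY THIS FILE. The S2 re-line of crux 20132 (skeleton v7: S2-KS + S2-LOC + S2-ENGINE) proves S2-ENGINE by
instantiating the tree's p-uniform engine-of-KS (`ZhangTriangulation.exists_ne_zero_of_zhangInduction_on_of_
kolyvaginSystem_finite_oddStart`) on the p-generic canonical level-raised Selmer spaces of akr-p1 g0's
`Theorems/AdditiveKolyvaginRoadLevelDefs.lean` (`levelSelmerSubgroupP`, `SelQP`, `SelRelQP`). The engine reads these
spaces through MEMBERSHIP DICTIONARIES (`hSel` ∕ `hSelRel`); this file is their model side at a general prime `p`:
pure unfolding of `levelSelmerSubgroupP` (an `⊓` of four parts, two of them `⨅`s over places with side conditions).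

WHAT. A class lies in the canonical level-`n` space relaxed at `S`, of sign `μ`, iff (i) complex conjugation `c` acts
on it by `sgnP μ`, (ii) it satisfies E's Kummer condition at every infinite place, (iii) E's Kummer condition at every
finite place above no prime of `n ∪ S`, and (iv) the TORIC condition (`toricLocalKer`) at every place above a prime of
`n ∖ S`: `mem_levelSelmerSubgroupP_iff` (levels as `Finset ℕ`), `mem_selQP_iff` ∕ `mem_selRelQP_iff` (levels as finite
sets of Bertolini–Darmon admissible primes `AdmQ W K p`). Proofs = zhang3-p1's, verbatim up to the renaming.

HONEST FRAMING: theorems only (definitional unfoldings); 0 definitions, 0 named facts, 0 `sorry`; closes nothing.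

References: [cite: WZhang2014, §5 (Sel_{𝔭_n}), Lemma 8.4 (3) (relaxed Selmer group)] [cite: BertoliniDarmon2005,
§2.3].
-/

-- single-conjunct summit: `Summit.BirchSwinnertonDyer.BirchSwinnertonDyer.…` repeats the name by design
set_option linter.dupNamespace false

noncomputable section

open scoped Classical

namespace Summit.BirchSwinnertonDyer.BirchSwinnertonDyer.Theorems.AdditiveKoly

open WeierstrassCurve NumberField IsDedekindDomain
  Literature.NumberTheory.EllipticCurves Literature.NumberTheory.GaloisRepresentations Module

variable (W : WeierstrassCurve ℚ) (K : Type) [Field K] [NumberField K] (p : ℕ) (c : K ≃ₐ[ℚ] K)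

/-- **Membership in the canonical space `levelSelmerSubgroupP n S μ`** (definitional unfolding): sign `sgnP μ` under
complex conjugation; Kummer at the infinite places; Kummer at the finite places above no prime of `n ∪ S`; TORIC at
the places above the primes of `n` not in `S`. [cite: WZhang2014, §5 (Sel_{𝔭_n})] [cite: BertoliniDarmon2005, §2.3] -/
theorem mem_levelSelmerSubgroupP_iff (n : Finset ℕ) (S : Set ℕ) (μ : Bool) (x : Vp W K p) :
    x ∈ levelSelmerSubgroupP W K p c n S μ ↔
      conjAct W c ((p ^ 1 : ℕ) : ℤ) x = sgnP μ • x ∧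
      (∀ w : InfinitePlace K, x ∈ selmerLocalKer (W.baseChange K) w.Completion ((p ^ 1 : ℕ) : ℤ)) ∧
      (∀ v : HeightOneSpectrum (𝓞 K), (∀ q ∈ (n : Set ℕ) ∪ S, (q : 𝓞 K) ∉ v.asIdeal) →
        x ∈ selmerLocalKer (W.baseChange K) (v.adicCompletion K) ((p ^ 1 : ℕ) : ℤ)) ∧
      (∀ q : ℕ, q ∈ n ∧ q ∉ S → ∀ v : HeightOneSpectrum (𝓞 K), (q : 𝓞 K) ∈ v.asIdeal →
        x ∈ toricLocalKer (W.baseChange K) (v.adicCompletion K) ((p ^ 1 : ℕ) : ℤ)) := by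
  unfold levelSelmerSubgroupP
  simp only [AddSubgroup.mem_inf, AddSubgroup.mem_iInf, AddMonoidHom.mem_ker, AddMonoidHom.sub_apply, sub_eq_zero]
  exact Iff.rfl

variable [W.IsGloballyMinimal] [Module (ZMod p) (Vp W K p)]

/-- **Membership in `SelQP n μ`** (`n` a finite set of Bertolini–Darmon admissible primes): sign; Kummer at the
infinite places; Kummer at the finite places above no prime of `n`; TORIC at the places above the primes of `n`.
[cite: WZhang2014, §5 (Sel_{𝔭_n})] [cite: BertoliniDarmon2005, §2.3] -/
theorem mem_selQP_iff (n : Finset (AdmQ W K p)) (μ : Bool) (x : Vp W K p) :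
    x ∈ SelQP W K p c n μ ↔
      conjAct W c ((p ^ 1 : ℕ) : ℤ) x = sgnP μ • x ∧
      (∀ w : InfinitePlace K, x ∈ selmerLocalKer (W.baseChange K) w.Completion ((p ^ 1 : ℕ) : ℤ)) ∧
      (∀ v : HeightOneSpectrum (𝓞 K), (∀ q ∈ n, ((q : ℕ) : 𝓞 K) ∉ v.asIdeal) →
        x ∈ selmerLocalKer (W.baseChange K) (v.adicCompletion K) ((p ^ 1 : ℕ) : ℤ)) ∧
      (∀ q ∈ n, ∀ v : HeightOneSpectrum (𝓞 K), ((q : ℕ) : 𝓞 K) ∈ v.asIdeal →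
        x ∈ toricLocalKer (W.baseChange K) (v.adicCompletion K) ((p ^ 1 : ℕ) : ℤ)) := by
  unfold SelQP
  rw [AddSubgroup.mem_toZModSubmodule, mem_levelSelmerSubgroupP_iff]
  refine and_congr_right fun _ ↦ and_congr_right fun _ ↦ ⟨fun ⟨h3, h4⟩ ↦ ⟨fun v hv ↦ ?_, fun q hq v hv ↦ ?_⟩,
    fun ⟨h3, h4⟩ ↦ ⟨fun v hv ↦ ?_, fun q hq v hv ↦ ?_⟩⟩
  · refine h3 v fun q' hq' ↦ ?_
    rcases hq' with hq' | hq'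
    · obtain ⟨a, ha, rfl⟩ := Finset.mem_image.mp (Finset.mem_coe.mp hq')
      exact hv a ha
    · exact absurd hq' (Set.notMem_empty _)
  · exact h4 (q : ℕ) ⟨Finset.mem_image_of_mem _ hq, Set.notMem_empty _⟩ v hv
  · exact h3 v fun a ha ↦ hv (a : ℕ) (Or.inl (Finset.mem_coe.mpr (Finset.mem_image_of_mem _ ha)))
  · obtain ⟨a, ha, rfl⟩ := Finset.mem_image.mp hq.1
    exact h4 a ha v hv

/-- **Membership in `SelRelQP n S μ`** (relaxed at the admissible primes of `S`): sign; Kummer at the infinite places;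
Kummer at the finite places above no prime of `n ∪ S`; TORIC at the places above the primes of `n ∖ S`; NO condition at
the places above `S`. [cite: WZhang2014, Lemma 8.4 (3) (relaxed Selmer group)] -/
theorem mem_selRelQP_iff (n : Finset (AdmQ W K p)) (S : Set (AdmQ W K p)) (μ : Bool) (x : Vp W K p) :
    x ∈ SelRelQP W K p c n S μ ↔
      conjAct W c ((p ^ 1 : ℕ) : ℤ) x = sgnP μ • x ∧
      (∀ w : InfinitePlace K, x ∈ selmerLocalKer (W.baseChange K) w.Completion ((p ^ 1 : ℕ) : ℤ)) ∧
      (∀ v : HeightOneSpectrum (𝓞 K), (∀ q ∈ n, ((q : ℕ) : 𝓞 K) ∉ v.asIdeal) →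
        (∀ q ∈ S, ((q : ℕ) : 𝓞 K) ∉ v.asIdeal) →
        x ∈ selmerLocalKer (W.baseChange K) (v.adicCompletion K) ((p ^ 1 : ℕ) : ℤ)) ∧
      (∀ q ∈ n, q ∉ S → ∀ v : HeightOneSpectrum (𝓞 K), ((q : ℕ) : 𝓞 K) ∈ v.asIdeal →
        x ∈ toricLocalKer (W.baseChange K) (v.adicCompletion K) ((p ^ 1 : ℕ) : ℤ)) := by
  unfold SelRelQP
  rw [AddSubgroup.mem_toZModSubmodule, mem_levelSelmerSubgroupP_iff]
  refine and_congr_right fun _ ↦ and_congr_right fun _ ↦ ⟨fun ⟨h3, h4⟩ ↦ ⟨fun v hv hvS ↦ ?_, fun q hq hqS v hv ↦ ?_⟩,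
    fun ⟨h3, h4⟩ ↦ ⟨fun v hv ↦ ?_, fun q hq v hv ↦ ?_⟩⟩
  · refine h3 v fun q' hq' ↦ ?_
    rcases hq' with hq' | hq'
    · obtain ⟨a, ha, rfl⟩ := Finset.mem_image.mp (Finset.mem_coe.mp hq')
      exact hv a ha
    · obtain ⟨a, ha, rfl⟩ := hq'
      exact hvS a ha
  · refine h4 (q : ℕ) ⟨Finset.mem_image_of_mem _ hq, fun h ↦ hqS ?_⟩ v hv
    obtain ⟨a, ha, hav⟩ := h
    rwa [← Subtype.ext hav]
  · exact h3 v (fun a ha ↦ hv (a : ℕ) (Or.inl (Finset.mem_coe.mpr (Finset.mem_image_of_mem _ ha))))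
      (fun a ha ↦ hv (a : ℕ) (Or.inr ⟨a, ha, rfl⟩))
  · obtain ⟨a, ha, rfl⟩ := Finset.mem_image.mp hq.1
    exact h4 a ha (fun haS ↦ hq.2 ⟨a, haS, rfl⟩) v hv

end Summit.BirchSwinnertonDyer.BirchSwinnertonDyer.Theorems.AdditiveKoly

end
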